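import Summits.Ventures.HSemireg.UntwistCocycleTwistDoor
import Summits.Ventures.HSemireg.UntwistCocycleTwistSigmaGeneral
import Summits.Ventures.HSemireg.AmplificationChainG2nTransport
import HarnessLib

/-!
# Venture HSemireg — route R1.0 CONSUMED BY THE END FORMS: the census-row ladder / cell theorems with the semiregularity
# certificate stated on `E₀` and the class certificate read on the twist `E₀ ⊗ M_c` (gs-g4; first end-form consumer of
# `HomComplex.isISemiregularC_iff_twist` / `CocycleTwist.isISemiregular_iff_twist_general`)

HONEST FRAMING. Lean index of the computation cell `pub-hsemireg` (general-structure seat gs-g4), venture lane. An ADAPTER leaf: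
nothing new in content, nothing about any explicit variety is asserted, every published input of the end forms stays a hypothesis
BY NAME (`weilFamilyReach_hyperbolic` / `weilFamilyReach_similar`, REFEREED; `PridhamPerfectLifts C` + Lieblich-type versal charts,
resp. `PerfectComplexRankTransfer C`, the venture's ASSUMPTIONS; `BuchweitzFlenner2003_variationalHodge_ISemiregular_model`, BF Thm. 5.1,
REFEREED) and everything else is BY VALUE. Nothing here says HC, HC_CM or HC_AV is proved; no census cell, door or verdict word moves
(by the signed verdict VERDICT-G6.md v1.0 no census row instantiates these binders on a deciding component).

WHAT THE LEAF DOES. In the untwisted reading of record of route R1.0 (cell rulings R-49(a)/R-51(a): on the split components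
`(2, ℚ(√-d))` with `d ≡ 3 (4)` — `d = 3` the STEP-0 component — the object of record is `E′ = E₀ ⊗ M_B` with `M_B` a LINE BUNDLE,
here `lineBundle c`; for `d = 3`, `M_B = 𝒫 ⊗ 𝒪(Θ_X ⊞ Θ_X̂)`) a census row certifies TWO things on TWO objects: the SEMIREGULARITY
certificate (joint injectivity of `(σ_q)_{q+1 ∈ I}`, «σ-rank = dim Ext²», and the `Ext` numbers) is computed on `E₀`; the CLASS
certificate (Markman's shape `ch_N = q·h_Kᴺ + w`, `ch_p = c_p·h_Kᵖ` off `N`; `ch(E₀ ⊗ M_B) = κ(E₀)`, `UntwistKappaClass.lean`) is read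
on `E₀ ⊗ M_B` — R-51(a) bridges the two on paper by the Leibniz rule `At(F ⊗ M) = At F ⊗ 1 + 1 ⊗ c₁(M)`. The cell's end forms (`AmplificationChainSigmaGluable`,
`AmplificationChainG2nTransport`, `ComponentCellsRouteC`, `AmplificationChainAssembly`) take both certificates on ONE complex `E`.
This file states the same rows with the binders split as the census delivers them — `hσ` on `K = E₀` (resp. `IsISemiregular` of a
vector bundle `E₀`; resp. the `Ext` numbers on a SOURCE `G` of `K`), the Chern data on `cocycleTwistComplex c K = K ⊗ M_c` (resp.
`twist c E₀`) — and derives them from the landed rows by the TREE theorems «untwisting preserves `I`-semiregularity»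
(`HomComplex.isISemiregularC_iff_twist`, `UntwistComplexSigmaTwist.lean`; `CocycleTwist.isISemiregular_iff_twist_general`,
`UntwistCocycleTwistSigmaGeneral.lean`), «the σ-door predicates are closed under cocycle twists»
(`CocycleTwist.gluableSigmaAdmissible_cocycleTwistComplex`, `UntwistCocycleTwistDoor.lean`) and «`Ext` ranks are twist-invariant»
(`CocycleTwist.extRank_cocycleTwistComplex`). EVERY unit `1`-cocycle `c` is allowed; the one price is that `{q | q + 1 ∈ I}` be a
LOWER SET (automatic for `I = {1, …, m}`: `CocycleTwist.isLowerSet_succ_mem_Icc`) — the Leibniz re-expansion mixes the lower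
components `σ_j`, `j < q`, into `σ′_q`. (Not an idle binder: for `I = {2}` alone, i.e. the single component `σ_1`, the structure sheaf
`𝒪_A` of an abelian threefold is NOT `{1}`-semiregular — `At(𝒪_A) = 0`, so `σ_1 = 0` on `Ext²(𝒪,𝒪) = H²(𝒪_A) ≠ 0` — while its twist by an
ample `L` is: `σ_1 = c₁(L) ∪ · : H²(𝒪_A) → H³(Ω¹_A)` is injective by hard Lefschetz; paper remark, not typed.)

CONTENTS (all proved; Mathlib + tree only; 0 `def`, 0 `sorry`, 0 new named fact): §1 object classes (`bfSheafClass_twist`,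
`perfectObjClass_gluable_twist`, `perfectObjClass_sigma_twist`); §2 seeds (`hasSeedOn_bfSheafClass_of_twist`,
`hasSeedOn_gluableSigmaObjClass_of_twist`, `hasSeedOn_rankObjClass_of_extRank_eq_twist`); §3 ladders on the split trust base, level `N`,
and `g = 4` (`ladder_of_reach_of_pridhamPerfect_of_versalCharts_of_gluableTwist` — rung R5, gluable σ-class;
`ladder_of_reach_of_BFmodel_of_sheafTwist` — BF Thm. 5.1; `ladder_of_reach_of_perfectComplexRankTransfer_of_extRank_eq_twist` — rank
door F-1 with `Ext` on a source; `weilFourfoldsSplit_…_of_gluableTwist`); §4 cell forms, any `(N, d, δ)`, and `g = 6`.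

## References

* R.-O. Buchweitz, H. Flenner, Compositio Math. 137 (2003), Def. 4.1, §5 (`I`-semiregular), Thm. 5.1. [BuchweitzFlenner2003]
* M. F. Atiyah, Trans. AMS 85 (1957), Prop. 10, Prop. 12 (Leibniz rule for the Atiyah class of `E ⊗ L`). [Atiyah1957]
* E. Markman, arXiv:2502.03415 v2, §1.3, §7.3 (`𝓑′ = 𝓑 ⊗` (twisted line bundle), `κ(𝓑) = κ(𝓑′) = ch(𝓑′)`; preprint). [Markman2025SecantWeil]
* J. P. Pridham, Forum Math. Sigma (2024), Cor. 2.25, Rem. 2.27. [Pridham2024Semiregularity]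
* M. Lieblich, J. Algebraic Geom. 15 (2006), Thm. 4.2.1. [Lieblich2006]
* P. Deligne, LNM 900 (1982), proof of Thm. 4.8. [Deligne1982HodgeCycles]
* R.-O. Buchweitz, H. Flenner, Adv. Math. 217 (2008), Prop. 6.4.4. [BuchweitzFlenner2008HH]
-/

noncomputable section

open CategoryTheory CategoryTheory.Limits AlgebraicGeometry Literature.AlgebraicGeometry Literature.AlgebraicGeometry.Modules
  Literature.AlgebraicGeometry.Motives Literature.AlgebraicGeometry.HodgeTheory Literature.AlgebraicGeometry.KTheory
  Literature.AlgebraicGeometry.ModuliOfAbelianVarieties Literature.AlgebraicGeometry.Deligne1982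
  Literature.AlgebraicGeometry.VanGeemen1994 Literature.AlgebraicTopology.SingularHomology

namespace Summit.Ventures.HSemireg

open CocycleTwist HomComplex Summit.HodgeConjecture.HodgeConjecture Summit.HodgeConjecture.HodgeConjecture.WeilTypeLadder
  Summit.HodgeConjecture.HodgeConjecture.Cruxes.HodgeAbelianVarieties.EStepSecantInduction
  Summit.HodgeConjecture.HodgeConjecture.Ring2.Hypotheses Summit.HodgeConjecture.HodgeConjecture.Ring2.AbelianAll
  Summit.Ventures.HSemireg.GeneralStructure

/-! ## §1 Object classes: the classes of `E₀ ⊗ M_c` are admissible as soon as `E₀` carries the semiregularity certificate -/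

section ObjectClasses

variable (C : ChernCharacterBetti) {n : ℕ} {X₀ : SchemeOver ℂ} {I : Finset ℕ} (c : UnitCocycle X₀.left)

/-- **BF's sheaf class under a twist**: if `E₀` is a finite locally free `{q | q+1 ∈ I}`-semiregular sheaf on `X₀` and
`{q | q+1 ∈ I}` is a lower set, then `(ch_p(E₀ ⊗ M_c))_p` is in the Buchweitz–Flenner sheaf class `bfSheafClass C` — the object
being `E₀ ⊗ M_c = twist c E₀`, finite locally free and `{q | q+1 ∈ I}`-semiregular by `CocycleTwist.isISemiregular_iff_twist_general`.
[cite: BuchweitzFlenner2003, §5 (I-semiregular) and Thm. 5.1 (hypotheses)] [cite: Atiyah1957, Prop. 10 and Prop. 12] -/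
theorem bfSheafClass_twist {E₀ : X₀.left.Modules} (hE₀ : IsFiniteLocallyFree E₀) (hIl : IsLowerSet {q : ℕ | q + 1 ∈ I})
    (hsr : IsISemiregular hE₀ {q | q + 1 ∈ I}) : bfSheafClass C n X₀ I (fun p => C.ch X₀ (twist c E₀) p) :=
  ⟨twist c E₀, isFiniteLocallyFree_twist c hE₀, (isISemiregular_iff_twist_general c hE₀ hIl).1 hsr, fun _ _ => rfl⟩

variable {K : CochainComplex X₀.left.Modules ℤ}

/-- **The gluable σ-class under a twist**: if the bounded complex of vector bundles `K` is gluable-σ-admissible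
(`{1..n} ⊆ I`, `Ext^{<0}(K,K) = 0`, `(σ_q(K))_{q+1 ∈ I}` jointly injective — NO `Hom = ℂ`) and `{q | q+1 ∈ I}` is a lower set, then the
Chern character of `K ⊗ M_c` (degrees in `I`) is in `perfectObjClass C gluableSigmaAdmissible` — the object being `K ⊗ M_c` itself
(`CocycleTwist.gluableSigmaAdmissible_cocycleTwistComplex`). [cite: BuchweitzFlenner2003, Def. 4.1 and §5 (I-semiregular)]
[cite: Lieblich2006, Thm. 4.2.1 and Prop. 2.1.9 (universally gluable)] -/
theorem perfectObjClass_gluable_twist (hK : IsBoundedVBComplex K) (hIl : IsLowerSet {q : ℕ | q + 1 ∈ I})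
    (hadm : gluableSigmaAdmissible n X₀ I K) :
    perfectObjClass C gluableSigmaAdmissible n X₀ I
      (fun p => chPerfect C X₀ (cocycleTwistComplex c K) (isFiniteLocallyFree_cocycleTwistComplex_X c hK.isFiniteLocallyFree) p) :=
  ⟨cocycleTwistComplex c K, isBoundedVBComplex_cocycleTwistComplex c hK,
    gluableSigmaAdmissible_cocycleTwistComplex c K hIl hadm, fun _ _ => rfl⟩

/-- **Target seat 7's σ-class under a twist** (`sigmaAdmissible`: the gluable clauses plus `Hom(K,K) = ℂ`, twist-invariant by
`CocycleTwist.extRank_cocycleTwistComplex`): `K` σ-admissible and `{q | q+1 ∈ I}` a lower set ⟹ `ch(K ⊗ M_c)|_I ∈ sigmaObjClass C`.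
[cite: BuchweitzFlenner2003, Def. 4.1 and §5 (I-semiregular)] -/
theorem perfectObjClass_sigma_twist (hK : IsBoundedVBComplex K) (hIl : IsLowerSet {q : ℕ | q + 1 ∈ I})
    (hadm : sigmaAdmissible n X₀ I K) :
    sigmaObjClass C n X₀ I
      (fun p => chPerfect C X₀ (cocycleTwistComplex c K) (isFiniteLocallyFree_cocycleTwistComplex_X c hK.isFiniteLocallyFree) p) :=
  ⟨cocycleTwistComplex c K, isBoundedVBComplex_cocycleTwistComplex c hK,
    sigmaAdmissible_cocycleTwistComplex c K hIl hadm, fun _ _ => rfl⟩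

end ObjectClasses

/-! ## §2 Seeds from a census row whose σ-certificate is on `E₀` and whose class certificate is on `E₀ ⊗ M_c` -/

variable {C : ChernCharacterBetti}

/-- **Sheaf seed, twisted reading** (BF's class, any level `N`): ON a complex abelian variety `P` with a degree-`2` class `h`, a finite
locally free `E₀` on `P.X` which is `{q | q+1 ∈ I}`-semiregular (BY VALUE), `{q | q+1 ∈ I}` a lower set, `N ∈ I`, a unit `1`-cocycle
`c`, and rationals with `ch_N(E₀ ⊗ M_c) = q·hᴺ + w`, `ch_p(E₀ ⊗ M_c) = c_p·hᵖ` off `N` ⟹ `HasSeedOn (bfSheafClass C) N P h w`.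
[cite: BuchweitzFlenner2003, §5 Thm. 5.1 (hypotheses)] [cite: Markman2025SecantWeil, §1.3 and §7.3 (the class of the twist; preprint)] -/
theorem hasSeedOn_bfSheafClass_of_twist {N : ℕ} (P : AbelianVariety ℂ) (h : complexBetti P.X 2) (w : complexBetti P.X (2 * N))
    (I : Finset ℕ) (hNI : N ∈ I) (hIl : IsLowerSet {q : ℕ | q + 1 ∈ I}) {E₀ : P.X.left.Modules} (hE₀ : IsFiniteLocallyFree E₀)
    (hsr : IsISemiregular hE₀ {q | q + 1 ∈ I}) (c : UnitCocycle P.X.left) (q : ℚ) (cf : ℕ → ℚ)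
    (hchN : C.ch P.X (twist c E₀) N = ((q : ℚ) : ℂ) • cupPowTwo h N + w)
    (hchp : ∀ p ∈ I, p ≠ N → C.ch P.X (twist c E₀) p = ((cf p : ℚ) : ℂ) • cupPowTwo h p) :
    HasSeedOn (bfSheafClass C) N P h w :=
  ⟨I, fun p => C.ch P.X (twist c E₀) p, q, cf, hNI, bfSheafClass_twist C c hE₀ hIl hsr, hchN, hchp⟩

/-- **Gluable-σ seed, twisted reading** (any level `N`; the currency of the STEP-0 (C) object and of the «D4 (residual)» row in the
untwisted reading of record): ON a complex abelian `2N`-fold `P` with a degree-`2` class `h`, `I ⊇ {1..2N}` with `{q | q+1 ∈ I}` a lower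
set, ONE bounded complex of vector bundles `K` (read: `E₀`) concentrated in `[a', b']` with `Ext^{<0}(K,K) = 0` and `(σ_q(K))_{q+1 ∈ I}`
JOINTLY INJECTIVE (`HomComplex.IsISemiregularC`, BY VALUE — the census's «σ-rank = dim Ext²»), a unit `1`-cocycle `c` (read: `M_B`), and
rationals with `ch_N(K ⊗ M_c) = q·hᴺ + w`, `ch_p(K ⊗ M_c) = c_p·hᵖ` off `N` (the census's class certificate, read on the twist) ⟹
`HasSeedOn (perfectObjClass C gluableSigmaAdmissible) N P h w` (the seed of `AmplificationChainG2nTransport.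
hasSeedOn_gluableSigmaObjClass_of_complex` for `E := K ⊗ M_c`, its `hσ` discharged from the one on `K`).
[cite: BuchweitzFlenner2003, Def. 4.1 and §5 (I-semiregular)] [cite: Markman2025SecantWeil, §1.3 and Cor. 1.3.2 (the class shape; preprint)] -/
theorem hasSeedOn_gluableSigmaObjClass_of_twist {N : ℕ} (hN : 1 ≤ N) (P : AbelianVariety ℂ)
    (h : complexBetti P.X 2) (w : complexBetti P.X (2 * N))
    (I : Finset ℕ) (hI : ∀ p : ℕ, 1 ≤ p → p ≤ 2 * N → p ∈ I) (hIl : IsLowerSet {q : ℕ | q + 1 ∈ I})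
    (K : CochainComplex P.X.left.Modules ℤ) (hK : IsBoundedVBComplex K) (hneg : ∀ k : ℤ, k < 0 → extRank P.X K k = 0)
    (a' b' : ℤ) [K.IsStrictlyGE a'] [K.IsStrictlyLE b']
    (hσ : letI := HasDerivedCategory.standard P.X.left.Modules
      HomComplex.IsISemiregularC P.X K a' b' hK.isFiniteLocallyFree {q | q + 1 ∈ I})
    (c : UnitCocycle P.X.left) (q : ℚ) (cf : ℕ → ℚ)
    (hchN : chPerfect C P.X (cocycleTwistComplex c K) (isFiniteLocallyFree_cocycleTwistComplex_X c hK.isFiniteLocallyFree) N =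
      ((q : ℚ) : ℂ) • cupPowTwo h N + w)
    (hchp : ∀ p ∈ I, p ≠ N →
      chPerfect C P.X (cocycleTwistComplex c K) (isFiniteLocallyFree_cocycleTwistComplex_X c hK.isFiniteLocallyFree) p =
        ((cf p : ℚ) : ℂ) • cupPowTwo h p) :
    HasSeedOn (perfectObjClass C gluableSigmaAdmissible) N P h w :=
  ⟨I, fun p => chPerfect C P.X (cocycleTwistComplex c K) (isFiniteLocallyFree_cocycleTwistComplex_X c hK.isFiniteLocallyFree) p,
    q, cf, hI N hN (by omega),
    perfectObjClass_gluable_twist C c hK hIl ⟨hI, hneg, a', b', inferInstance, inferInstance, hK.isFiniteLocallyFree, hσ⟩,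
    hchN, hchp⟩

/-- **Rank-door seed, twisted reading with the `Ext` numbers on a SOURCE object** (seat p4's `rankObjClass C`, any level `N`): the
row of `hasSeedOn_rankObjClass_of_extRank_eq` for `E := K ⊗ M_c`, where the bare equalities `extRank P.X K m = extRank Y₀ G m` (`m ≤ 2`;
what a derived equivalence `K = Φ(G)` gives) are stated for `K` and moved to `K ⊗ M_c` by `CocycleTwist.extRank_cocycleTwistComplex`;
`Ext^{<0}(G,G) = 0`, `Hom(G,G) = ℂ` and the rank certificate `rank Ext²(G,G) ≤ r(P, ch(K ⊗ M_c))` on the source, the Chern data on the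
twist. (The STEP-0 shape: `G = I_p ⊠ I_q`, `K = Φ(G)`, class read on `K ⊗ M_B`.) [cite: BuchweitzFlenner2008HH, Prop. 6.4.4]
[cite: Markman2025SecantWeil, §1.3 and §7.3 (preprint)] -/
theorem hasSeedOn_rankObjClass_of_extRank_eq_twist {N : ℕ} (hN : 1 ≤ N) (P : AbelianVariety ℂ) (hP : P.dim = 2 * N)
    (h : complexBetti P.X 2) (w : complexBetti P.X (2 * N))
    (I : Finset ℕ) (hI : ∀ p : ℕ, 1 ≤ p → p ≤ 2 * N → p ∈ I) (K : CochainComplex P.X.left.Modules ℤ)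
    (hK : IsBoundedVBComplex K) (c : UnitCocycle P.X.left) (q : ℚ) (cf : ℕ → ℚ)
    (hchN : chPerfect C P.X (cocycleTwistComplex c K) (isFiniteLocallyFree_cocycleTwistComplex_X c hK.isFiniteLocallyFree) N =
      ((q : ℚ) : ℂ) • cupPowTwo h N + w)
    (hchp : ∀ p ∈ I, p ≠ N →
      chPerfect C P.X (cocycleTwistComplex c K) (isFiniteLocallyFree_cocycleTwistComplex_X c hK.isFiniteLocallyFree) p =
        ((cf p : ℚ) : ℂ) • cupPowTwo h p)
    {Y₀ : SchemeOver ℂ} (G : CochainComplex Y₀.left.Modules ℤ)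
    (hext : ∀ m : ℤ, m ≤ 2 → extRank P.X K m = extRank Y₀ G m)
    (hneg : ∀ k : ℤ, k < 0 → extRank Y₀ G k = 0) (h0 : extRank Y₀ G 0 = 1)
    (h2 : extRank Y₀ G 2 ≤ Cardinal.lift.{1} (contractionRank P fun p ↦
      chPerfect C P.X (cocycleTwistComplex c K) (isFiniteLocallyFree_cocycleTwistComplex_X c hK.isFiniteLocallyFree) p)) :
    HasSeedOn (rankObjClass C) N P h w :=
  hasSeedOn_rankObjClass_of_extRank_eq hN P hP h w I hI (cocycleTwistComplex c K) (isBoundedVBComplex_cocycleTwistComplex c hK)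
    q cf hchN hchp G (fun m hm => (extRank_cocycleTwistComplex P.X c K m).trans (hext m hm)) hneg h0 h2

/-! ## §3 Ladders on the split trust base, level `N` (and `g = 4`) -/

/-- **The `g = 2N` census-row LADDER theorem on rung R5 in the gluable σ-class, TWISTED READING.** Granting BY NAME Deligne's
hyperbolic reach (`weilFamilyReach_hyperbolic`, REFEREED), (F) `PridhamPerfectLifts C` and Lieblich-type versal charts in EXISTENCE
form (as in `ladder_of_reach_of_pridhamPerfect_of_versalCharts_of_gluableComplex`): a split ℚ(√−d)-Weil anchor `(P, ψ₀, e, a)` of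
dimension `2N`, `w ≠ 0` rational Weil, `I ⊇ {1..2N}` with `{q | q+1 ∈ I}` a lower set, ONE bounded complex of vector bundles `K` in
`[a', b']` with `Ext^{<0}(K,K) = 0` and `(σ_q(K))_{q+1 ∈ I}` jointly injective (BY VALUE), a unit `1`-cocycle `c`, and the class
shape `ch_N(K ⊗ M_c) = q·h_Kᴺ + w`, `ch_p(K ⊗ M_c) = c_p·h_Kᵖ` off `N` read ON THE TWIST ⟹ the Weil classes are algebraic on EVERY
split ℚ(√−d)-Weil `2N`-fold AND on every ℚ(√−d)-Weil `2n`-fold for `2 ≤ n < N`. (= that ladder theorem at `E := K ⊗ M_c`, its `hσ`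
supplied by `HomComplex.isISemiregularC_iff_twist`.) Nothing asserted; no census row supplies these binders on a deciding component.
[cite: Pridham2024Semiregularity, Cor. 2.25; Rem. 2.27] [cite: Lieblich2006, Thm. 4.2.1] [cite: Deligne1982HodgeCycles, proof of Thm. 4.8]
[cite: BuchweitzFlenner2003, Def. 4.1 and §5 (I-semiregular)] [cite: Atiyah1957, Prop. 10 and Prop. 12] -/
theorem ladder_of_reach_of_pridhamPerfect_of_versalCharts_of_gluableTwist
    (hF : weilFamilyReach_hyperbolic) (hP : PridhamPerfectLifts C)
    (hV : ∀ ⦃𝒳 S : SchemeOver ℂ⦄ (π : 𝒳 ⟶ S) (n : ℕ),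
      IsSmoothProjectiveFamily π n → _root_.AlgebraicGeometry.Smooth S.hom →
      ∀ (s₀ : ComplexPoints S) (X₀ : SchemeOver ℂ) (e : X₀ ≅ fiberOver π s₀)
        (E : CochainComplex X₀.left.Modules ℤ), IsBoundedVBComplex E →
        (∀ k : ℤ, k < 0 → extRank X₀ E k = 0) → HasVersalPerfectChartAt π s₀ X₀ e E)
    {N d : ℕ} (hN : 1 ≤ N) (hd : 0 < d)
    (P : AbelianVariety ℂ) (ψ₀ : P ⟶ P) (e : ProjectiveEmbedding P.X) (a : complexBetti (projectiveSpace e.n ℂ) 2)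
    (hP2 : P.dim = 2 * N) (hψ : ψ₀ ≫ ψ₀ = -(d • 𝟙 P)) (ha : IsRationalClass a) (ha0 : a ≠ 0)
    (hhyp : IsHyperbolicWeilType P ψ₀ N (symmetrisedClass d P ψ₀ e a))
    (w : complexBetti P.X (2 * N)) (hwW : w ∈ weilClassesOf P ψ₀ N d) (hwr : IsRationalClass w) (hw0 : w ≠ 0)
    (I : Finset ℕ) (hI : ∀ p : ℕ, 1 ≤ p → p ≤ 2 * N → p ∈ I) (hIl : IsLowerSet {q : ℕ | q + 1 ∈ I})
    (K : CochainComplex P.X.left.Modules ℤ) (hK : IsBoundedVBComplex K) (hneg : ∀ k : ℤ, k < 0 → extRank P.X K k = 0)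
    (a' b' : ℤ) [K.IsStrictlyGE a'] [K.IsStrictlyLE b']
    (hσ : letI := HasDerivedCategory.standard P.X.left.Modules
      HomComplex.IsISemiregularC P.X K a' b' hK.isFiniteLocallyFree {q | q + 1 ∈ I})
    (c : UnitCocycle P.X.left) (q : ℚ) (cf : ℕ → ℚ)
    (hchN : chPerfect C P.X (cocycleTwistComplex c K) (isFiniteLocallyFree_cocycleTwistComplex_X c hK.isFiniteLocallyFree) N =
      ((q : ℚ) : ℂ) • cupPowTwo (symmetrisedClass d P ψ₀ e a) N + w)
    (hchp : ∀ p ∈ I, p ≠ N →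
      chPerfect C P.X (cocycleTwistComplex c K) (isFiniteLocallyFree_cocycleTwistComplex_X c hK.isFiniteLocallyFree) p =
        ((cf p : ℚ) : ℂ) • cupPowTwo (symmetrisedClass d P ψ₀ e a) p) :
    Stubs.WeilAlgebraicSplitHyperplane N d ∧ ∀ n : ℕ, 2 ≤ n → n < N → WeilAlgebraicAll n d := by
  have hT : LocalVariationalHodgeFor (perfectObjClass C gluableSigmaAdmissible) :=
    (perfectComplexDeformsOverEtaleNbhd_gluable_of_pridhamPerfect_of_versalCharts hP hV).localVariationalHodgeFor
  have hS : HasHyperbolicSeedOn (perfectObjClass C gluableSigmaAdmissible) N d :=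
    hasHyperbolicSeedOn_of_hasSeedOn P ψ₀ e a hP2 hψ ha ha0 hhyp hwW hwr hw0
      (hasSeedOn_gluableSigmaObjClass_of_twist hN P _ w I hI hIl K hK hneg a' b' hσ c q cf hchN hchp)
  exact ⟨splitHyperplane_of_reach_of_localVariationalHodgeFor_of_hyperbolicSeedOn hF hN hd hT hS,
    fun n hn hnN ↦ weilAlgebraicAll_of_localVariationalHodgeFor_of_hyperbolicSeedOn_lt hF hT hS hn hnN hd⟩

/-- **`g = 4`, route (C), σ-tier, rung R5, TWISTED READING** — `weilFourfoldsSplit_of_reach_of_pridhamPerfect_of_versalCharts_of_gluableComplex`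
with the σ-certificate on `K` and the class certificate on `K ⊗ M_c`: the shape of the STEP-0 (C) row in the untwisted reading of record
(`E₀ = Φ(I_p ⊠ I_q)`, σ on `Ext²(E₀, E₀)`; class `κ(E₀) = ch(E₀ ⊗ M_B)` of Markman's shape). Conclusion `Stubs.WeilAlgebraicSplitHyperplane 2 d`
(in print: [Markman2023GeneralizedKummers] Thm. 1.5 (= Thm. 13.4), the split fourfold component; re-derived CONDITIONALLY, no new case).
[cite: Markman2023GeneralizedKummers, Theorem 1.5 (= Theorem 13.4), p. 236] [cite: Pridham2024Semiregularity, Cor. 2.25; Rem. 2.27]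
[cite: Deligne1982HodgeCycles, proof of Thm. 4.8] [cite: Markman2025SecantWeil, §7.3 (the trivial-determinant twist; preprint)] -/
theorem weilFourfoldsSplit_of_reach_of_pridhamPerfect_of_versalCharts_of_gluableTwist
    (hF : weilFamilyReach_hyperbolic) (hP : PridhamPerfectLifts C)
    (hV : ∀ ⦃𝒳 S : SchemeOver ℂ⦄ (π : 𝒳 ⟶ S) (n : ℕ),
      IsSmoothProjectiveFamily π n → _root_.AlgebraicGeometry.Smooth S.hom →
      ∀ (s₀ : ComplexPoints S) (X₀ : SchemeOver ℂ) (e : X₀ ≅ fiberOver π s₀)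
        (E : CochainComplex X₀.left.Modules ℤ), IsBoundedVBComplex E →
        (∀ k : ℤ, k < 0 → extRank X₀ E k = 0) → HasVersalPerfectChartAt π s₀ X₀ e E)
    {d : ℕ} (hd : 0 < d)
    (P : AbelianVariety ℂ) (ψ₀ : P ⟶ P) (e : ProjectiveEmbedding P.X) (a : complexBetti (projectiveSpace e.n ℂ) 2)
    (hP4 : P.dim = 2 * 2) (hψ : ψ₀ ≫ ψ₀ = -(d • 𝟙 P)) (ha : IsRationalClass a) (ha0 : a ≠ 0)
    (hhyp : IsHyperbolicWeilType P ψ₀ 2 (symmetrisedClass d P ψ₀ e a))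
    (w : complexBetti P.X (2 * 2)) (hwW : w ∈ weilClassesOf P ψ₀ 2 d) (hwr : IsRationalClass w) (hw0 : w ≠ 0)
    (I : Finset ℕ) (hI : ∀ p : ℕ, 1 ≤ p → p ≤ 2 * 2 → p ∈ I) (hIl : IsLowerSet {q : ℕ | q + 1 ∈ I})
    (K : CochainComplex P.X.left.Modules ℤ) (hK : IsBoundedVBComplex K) (hneg : ∀ k : ℤ, k < 0 → extRank P.X K k = 0)
    (a' b' : ℤ) [K.IsStrictlyGE a'] [K.IsStrictlyLE b']
    (hσ : letI := HasDerivedCategory.standard P.X.left.Modules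
      HomComplex.IsISemiregularC P.X K a' b' hK.isFiniteLocallyFree {q | q + 1 ∈ I})
    (c : UnitCocycle P.X.left) (q : ℚ) (cf : ℕ → ℚ)
    (hch2 : chPerfect C P.X (cocycleTwistComplex c K) (isFiniteLocallyFree_cocycleTwistComplex_X c hK.isFiniteLocallyFree) 2 =
      ((q : ℚ) : ℂ) • cupPowTwo (symmetrisedClass d P ψ₀ e a) 2 + w)
    (hchp : ∀ p ∈ I, p ≠ 2 →
      chPerfect C P.X (cocycleTwistComplex c K) (isFiniteLocallyFree_cocycleTwistComplex_X c hK.isFiniteLocallyFree) p =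
        ((cf p : ℚ) : ℂ) • cupPowTwo (symmetrisedClass d P ψ₀ e a) p) :
    Stubs.WeilAlgebraicSplitHyperplane 2 d :=
  (ladder_of_reach_of_pridhamPerfect_of_versalCharts_of_gluableTwist hF hP hV (by norm_num) hd P ψ₀ e a hP4 hψ ha ha0 hhyp w hwW
    hwr hw0 I hI hIl K hK hneg a' b' hσ c q cf hch2 hchp).1

/-- **The `g = 2N` LADDER through the SHEAF door, TWISTED READING** (BF Thm. 5.1, REFEREED, model rendering; Deligne's hyperbolic reach,
REFEREED): a split ℚ(√−d)-Weil anchor of dimension `2N`, `w ≠ 0` rational Weil, `N ∈ I` with `{q | q+1 ∈ I}` a lower set, ONE finite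
locally free `E₀` on `P.X` which is `{q | q+1 ∈ I}`-semiregular (BY VALUE), a unit `1`-cocycle `c`, and the class shape
`ch_N(E₀ ⊗ M_c) = q·h_Kᴺ + w`, `ch_p(E₀ ⊗ M_c) = c_p·h_Kᵖ` off `N` ⟹ split ℚ(√−d)-Weil `2N`-folds AND every ℚ(√−d)-Weil `2n`-fold,
`2 ≤ n < N`. The only venture-free door: every hypothesis by name is refereed. (Instance, for the record: no such vector bundle is
claimed by the cell.) [cite: BuchweitzFlenner2003, §5 Thm. 5.1] [cite: Deligne1982HodgeCycles, proof of Thm. 4.8]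
[cite: Atiyah1957, Prop. 10 and Prop. 12] -/
theorem ladder_of_reach_of_BFmodel_of_sheafTwist (hF : weilFamilyReach_hyperbolic)
    (hBF : BuchweitzFlenner2003_variationalHodge_ISemiregular_model) (C : ChernCharacterBetti) {N d : ℕ} (hN : 1 ≤ N) (hd : 0 < d)
    (P : AbelianVariety ℂ) (ψ₀ : P ⟶ P) (e : ProjectiveEmbedding P.X) (a : complexBetti (projectiveSpace e.n ℂ) 2)
    (hP2 : P.dim = 2 * N) (hψ : ψ₀ ≫ ψ₀ = -(d • 𝟙 P)) (ha : IsRationalClass a) (ha0 : a ≠ 0)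
    (hhyp : IsHyperbolicWeilType P ψ₀ N (symmetrisedClass d P ψ₀ e a))
    (w : complexBetti P.X (2 * N)) (hwW : w ∈ weilClassesOf P ψ₀ N d) (hwr : IsRationalClass w) (hw0 : w ≠ 0)
    (I : Finset ℕ) (hNI : N ∈ I) (hIl : IsLowerSet {q : ℕ | q + 1 ∈ I})
    {E₀ : P.X.left.Modules} (hE₀ : IsFiniteLocallyFree E₀) (hsr : IsISemiregular hE₀ {q | q + 1 ∈ I})
    (c : UnitCocycle P.X.left) (q : ℚ) (cf : ℕ → ℚ)
    (hchN : C.ch P.X (twist c E₀) N = ((q : ℚ) : ℂ) • cupPowTwo (symmetrisedClass d P ψ₀ e a) N + w)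
    (hchp : ∀ p ∈ I, p ≠ N → C.ch P.X (twist c E₀) p = ((cf p : ℚ) : ℂ) • cupPowTwo (symmetrisedClass d P ψ₀ e a) p) :
    Stubs.WeilAlgebraicSplitHyperplane N d ∧ ∀ n : ℕ, 2 ≤ n → n < N → WeilAlgebraicAll n d := by
  have hT : LocalVariationalHodgeFor (bfSheafClass C) := localVariationalHodgeFor_bfSheafClass hBF C
  have hS : HasHyperbolicSeedOn (bfSheafClass C) N d :=
    hasHyperbolicSeedOn_of_hasSeedOn P ψ₀ e a hP2 hψ ha ha0 hhyp hwW hwr hw0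
      (hasSeedOn_bfSheafClass_of_twist P _ w I hNI hIl hE₀ hsr c q cf hchN hchp)
  exact ⟨splitHyperplane_of_reach_of_localVariationalHodgeFor_of_hyperbolicSeedOn hF hN hd hT hS,
    fun n hn hnN ↦ weilAlgebraicAll_of_localVariationalHodgeFor_of_hyperbolicSeedOn_lt hF hT hS hn hnN hd⟩

/-- **The `g = 2N` LADDER through the rank door (F-1), TWISTED READING with the `Ext` numbers on a SOURCE object** — the exact shape
of the STEP-0 (C) row of record (`G = I_p ⊠ I_q` on `X × X`, `K = Φ(G)` on `P = X × X̂` by Mukai's equivalence, `dim Extⁱ(K,K) =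
dim Extⁱ(G,G)` («FM-INV»), class `κ(K) = ch(K ⊗ M_B)` of Markman's shape, rank certificate `r(P, ch(K ⊗ M_B)) ≥ dim Ext²(G,G)`):
granting BY NAME `weilFamilyReach_hyperbolic` (REFEREED) and the venture's ASSUMPTION `PerfectComplexRankTransfer C` (F-1) ⟹ split
ℚ(√−d)-Weil `2N`-folds AND every ℚ(√−d)-Weil `2n`-fold, `2 ≤ n < N` (= `ladder_of_reach_of_perfectComplexRankTransfer_of_extRank_eq`
at `E := K ⊗ M_c`, `hext` moved across the twist by `CocycleTwist.extRank_cocycleTwistComplex`). Nothing asserted.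
[cite: BuchweitzFlenner2008HH, Prop. 6.4.4] [cite: Pridham2024Semiregularity, Cor. 2.25, Rem. 2.27] [cite: Mukai1981, p. 156 L25–27]
[cite: Deligne1982HodgeCycles, proof of Thm. 4.8] [cite: Markman2025SecantWeil, §1.3 and §7.3 (preprint)] -/
theorem ladder_of_reach_of_perfectComplexRankTransfer_of_extRank_eq_twist (hF : weilFamilyReach_hyperbolic)
    (hT : PerfectComplexRankTransfer C) {N d : ℕ} (hN : 1 ≤ N) (hd : 0 < d)
    (P : AbelianVariety ℂ) (ψ₀ : P ⟶ P) (e : ProjectiveEmbedding P.X) (a : complexBetti (projectiveSpace e.n ℂ) 2)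
    (hP2 : P.dim = 2 * N) (hψ : ψ₀ ≫ ψ₀ = -(d • 𝟙 P)) (ha : IsRationalClass a) (ha0 : a ≠ 0)
    (hhyp : IsHyperbolicWeilType P ψ₀ N (symmetrisedClass d P ψ₀ e a))
    (w : complexBetti P.X (2 * N)) (hwW : w ∈ weilClassesOf P ψ₀ N d) (hwr : IsRationalClass w) (hw0 : w ≠ 0)
    (I : Finset ℕ) (hI : ∀ p : ℕ, 1 ≤ p → p ≤ 2 * N → p ∈ I) (K : CochainComplex P.X.left.Modules ℤ)
    (hK : IsBoundedVBComplex K) (c : UnitCocycle P.X.left) (q : ℚ) (cf : ℕ → ℚ)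
    (hchN : chPerfect C P.X (cocycleTwistComplex c K) (isFiniteLocallyFree_cocycleTwistComplex_X c hK.isFiniteLocallyFree) N =
      ((q : ℚ) : ℂ) • cupPowTwo (symmetrisedClass d P ψ₀ e a) N + w)
    (hchp : ∀ p ∈ I, p ≠ N →
      chPerfect C P.X (cocycleTwistComplex c K) (isFiniteLocallyFree_cocycleTwistComplex_X c hK.isFiniteLocallyFree) p =
        ((cf p : ℚ) : ℂ) • cupPowTwo (symmetrisedClass d P ψ₀ e a) p)
    {Y₀ : SchemeOver ℂ} (G : CochainComplex Y₀.left.Modules ℤ)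
    (hext : ∀ m : ℤ, m ≤ 2 → extRank P.X K m = extRank Y₀ G m)
    (hneg : ∀ k : ℤ, k < 0 → extRank Y₀ G k = 0) (h0 : extRank Y₀ G 0 = 1)
    (h2 : extRank Y₀ G 2 ≤ Cardinal.lift.{1} (contractionRank P fun p ↦
      chPerfect C P.X (cocycleTwistComplex c K) (isFiniteLocallyFree_cocycleTwistComplex_X c hK.isFiniteLocallyFree) p)) :
    Stubs.WeilAlgebraicSplitHyperplane N d ∧ ∀ n : ℕ, 2 ≤ n → n < N → WeilAlgebraicAll n d :=
  ladder_of_reach_of_perfectComplexRankTransfer_of_extRank_eq hF hT hN hd P ψ₀ e a hP2 hψ ha ha0 hhyp w hwW hwr hw0 I hI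
    (cocycleTwistComplex c K) (isBoundedVBComplex_cocycleTwistComplex c hK) q cf hchN hchp G
    (fun m hm => (extRank_cocycleTwistComplex P.X c K m).trans (hext m hm)) hneg h0 h2

/-! ## §4 Cell forms (any `(N, d, δ)`, non-split included; `g = 6`) -/

/-- **Cell form `(N, d, δ)`, gluable σ-seed, rung R5, TWISTED READING.** BY NAME: `weilFamilyReach_similar` (Deligne's reach by
similitudes, REFEREED), (F) `PridhamPerfectLifts C`, Lieblich-type versal charts in existence form. BY VALUE: a polarized Weil-type
`(N, d)` member `(P, ψ₀, h_K)` of the cell `δ` with its Gram placement, a non-zero rational Weil class `w`, `I ⊇ {1..2N}` with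
`{q | q+1 ∈ I}` a lower set, ONE bounded complex of vector bundles `K` in `[a', b']` with `Ext^{<0}(K,K) = 0` and `(σ_q(K))_{q+1 ∈ I}`
jointly injective, a unit `1`-cocycle `c`, and the class shape read on `K ⊗ M_c` ⟹ `WeilClassesComponent N d δ`
(`weilClassesComponent_of_localVariationalHodgeFor_of_seedOn_member` fed with the twisted seed of §2). Nothing asserted; no census row
supplies these binders on a deciding component. [cite: Deligne1982HodgeCycles, proof of Thm. 4.8]
[cite: Pridham2024Semiregularity, Cor. 2.25; Rem. 2.27] [cite: Lieblich2006, Thm. 4.2.1] [cite: EGAIV4, Prop. 17.14.2 and Cor. 17.16.3 (i)]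
[cite: BuchweitzFlenner2003, Def. 4.1 and §5 (I-semiregular)] -/
theorem weilClassesComponent_of_reachSimilar_of_pridhamPerfect_of_versalCharts_of_gluableTwist {N d : ℕ}
    {δ : weilNormResidueGroup d} (hF : weilFamilyReach_similar) (hP : PridhamPerfectLifts C)
    (hV : ∀ ⦃𝒳 S : SchemeOver ℂ⦄ (π : 𝒳 ⟶ S) (n : ℕ),
      IsSmoothProjectiveFamily π n → _root_.AlgebraicGeometry.Smooth S.hom →
      ∀ (s₀ : ComplexPoints S) (X₀ : SchemeOver ℂ) (e : X₀ ≅ fiberOver π s₀)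
        (E : CochainComplex X₀.left.Modules ℤ), IsBoundedVBComplex E →
        (∀ k : ℤ, k < 0 → extRank X₀ E k = 0) → HasVersalPerfectChartAt π s₀ X₀ e E)
    {P : AbelianVariety ℂ} {ψ₀ : P ⟶ P} (hW : IsWeilType P ψ₀ N d) (e : ProjectiveEmbedding P.X)
    {a : complexBetti (projectiveSpace e.n ℂ) 2} (haQ : IsRationalClass a) (ha0 : a ≠ 0)
    (hδ : HasWeilDiscriminantNondeg P ψ₀ N d (symmetrisedClass d P ψ₀ e a) δ)
    {w : complexBetti P.X (2 * N)} (hwW : w ∈ weilClassesOf P ψ₀ N d) (hwQ : IsRationalClass w) (hw0 : w ≠ 0)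
    (I : Finset ℕ) (hI : ∀ p : ℕ, 1 ≤ p → p ≤ 2 * N → p ∈ I) (hIl : IsLowerSet {q : ℕ | q + 1 ∈ I})
    (K : CochainComplex P.X.left.Modules ℤ) (hK : IsBoundedVBComplex K) (hneg : ∀ k : ℤ, k < 0 → extRank P.X K k = 0)
    (a' b' : ℤ) [K.IsStrictlyGE a'] [K.IsStrictlyLE b']
    (hσ : letI := HasDerivedCategory.standard P.X.left.Modules
      HomComplex.IsISemiregularC P.X K a' b' hK.isFiniteLocallyFree {q | q + 1 ∈ I})
    (c : UnitCocycle P.X.left) (q : ℚ) (cf : ℕ → ℚ)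
    (hchN : chPerfect C P.X (cocycleTwistComplex c K) (isFiniteLocallyFree_cocycleTwistComplex_X c hK.isFiniteLocallyFree) N =
      ((q : ℚ) : ℂ) • cupPowTwo (symmetrisedClass d P ψ₀ e a) N + w)
    (hchp : ∀ p ∈ I, p ≠ N →
      chPerfect C P.X (cocycleTwistComplex c K) (isFiniteLocallyFree_cocycleTwistComplex_X c hK.isFiniteLocallyFree) p =
        ((cf p : ℚ) : ℂ) • cupPowTwo (symmetrisedClass d P ψ₀ e a) p) :
    WeilClassesComponent N d δ :=
  weilClassesComponent_of_localVariationalHodgeFor_of_seedOn_member hF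
    (perfectComplexDeformsOverEtaleNbhd_gluable_of_pridhamPerfect_of_versalCharts hP hV).localVariationalHodgeFor hW e haQ ha0
    hδ hwW hwQ hw0 (hasSeedOn_gluableSigmaObjClass_of_twist hW.pos P _ w I hI hIl K hK hneg a' b' hσ c q cf hchN hchp)

/-- **`g = 6`, route (C), σ-tier, rung R5, TWISTED READING** (`weilSixfoldComponent_of_reachSimilar_of_pridhamPerfect_of_versalCharts_of_gluableComplex`
with the σ-certificate on `K` and the class certificate on `K ⊗ M_c`): `WeilClassesComponent 3 d δ`. The deciding rows of the `g = 6`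
programme are the NON-SPLIT `δ`; by VERDICT-G6 v1.0 no census row supplies these binders there. Nothing asserted.
[cite: Deligne1982HodgeCycles, proof of Thm. 4.8] [cite: Pridham2024Semiregularity, Cor. 2.25; Rem. 2.27] [cite: BuchweitzFlenner2003, §5 (I-semiregular)] -/
theorem weilSixfoldComponent_of_reachSimilar_of_pridhamPerfect_of_versalCharts_of_gluableTwist {d : ℕ}
    {δ : weilNormResidueGroup d} (hF : weilFamilyReach_similar) (hP : PridhamPerfectLifts C)
    (hV : ∀ ⦃𝒳 S : SchemeOver ℂ⦄ (π : 𝒳 ⟶ S) (n : ℕ),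
      IsSmoothProjectiveFamily π n → _root_.AlgebraicGeometry.Smooth S.hom →
      ∀ (s₀ : ComplexPoints S) (X₀ : SchemeOver ℂ) (e : X₀ ≅ fiberOver π s₀)
        (E : CochainComplex X₀.left.Modules ℤ), IsBoundedVBComplex E →
        (∀ k : ℤ, k < 0 → extRank X₀ E k = 0) → HasVersalPerfectChartAt π s₀ X₀ e E)
    {P : AbelianVariety ℂ} {ψ₀ : P ⟶ P} (hW : IsWeilType P ψ₀ 3 d) (e : ProjectiveEmbedding P.X)
    {a : complexBetti (projectiveSpace e.n ℂ) 2} (haQ : IsRationalClass a) (ha0 : a ≠ 0)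
    (hδ : HasWeilDiscriminantNondeg P ψ₀ 3 d (symmetrisedClass d P ψ₀ e a) δ)
    {w : complexBetti P.X 6} (hwW : w ∈ weilClassesOf P ψ₀ 3 d) (hwQ : IsRationalClass w) (hw0 : w ≠ 0)
    (I : Finset ℕ) (hI : ∀ p : ℕ, 1 ≤ p → p ≤ 2 * 3 → p ∈ I) (hIl : IsLowerSet {q : ℕ | q + 1 ∈ I})
    (K : CochainComplex P.X.left.Modules ℤ) (hK : IsBoundedVBComplex K) (hneg : ∀ k : ℤ, k < 0 → extRank P.X K k = 0)
    (a' b' : ℤ) [K.IsStrictlyGE a'] [K.IsStrictlyLE b']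
    (hσ : letI := HasDerivedCategory.standard P.X.left.Modules
      HomComplex.IsISemiregularC P.X K a' b' hK.isFiniteLocallyFree {q | q + 1 ∈ I})
    (c : UnitCocycle P.X.left) (q : ℚ) (cf : ℕ → ℚ)
    (hch3 : chPerfect C P.X (cocycleTwistComplex c K) (isFiniteLocallyFree_cocycleTwistComplex_X c hK.isFiniteLocallyFree) 3 =
      ((q : ℚ) : ℂ) • cupPowTwo (symmetrisedClass d P ψ₀ e a) 3 + w)
    (hchp : ∀ p ∈ I, p ≠ 3 →
      chPerfect C P.X (cocycleTwistComplex c K) (isFiniteLocallyFree_cocycleTwistComplex_X c hK.isFiniteLocallyFree) p =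
        ((cf p : ℚ) : ℂ) • cupPowTwo (symmetrisedClass d P ψ₀ e a) p) :
    WeilClassesComponent 3 d δ :=
  weilClassesComponent_of_reachSimilar_of_pridhamPerfect_of_versalCharts_of_gluableTwist hF hP hV hW e haQ ha0 hδ hwW hwQ hw0 I
    hI hIl K hK hneg a' b' hσ c q cf hch3 hchp

/-! ## Audit: nothing is decided here
Every theorem with a Weil conclusion carries BY VALUE a census row split as the census delivers it (semiregularity certificate on `K` /
`E₀`, or `Ext` numbers + rank certificate on a source `G`; class certificate on the twist `K ⊗ M_c` / `E₀ ⊗ M_c`) AND the transfer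
statement for the same object class BY NAME (`PridhamPerfectLifts C` ∧ versal charts / `PerfectComplexRankTransfer C`, assumptions of
the venture; or BF Thm. 5.1, refereed), plus the refereed reach fact; the bridge between the two objects is the TREE theorem «untwisting
preserves `I`-semiregularity» (route R1.0). `HC_CM`, CM density, Mumford–Tate finiteness do not occur. 0 `def`, 0 named fact, 0 `sorry`. -/

end Summit.Ventures.HSemireg

end
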